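import Summits.Ventures.LatticeQCDFlow.Scoring.WilsonFlowRK3
import Summits.Ventures.LatticeQCDFlow.Scoring.CloverChargeLawSymmetric
import Summits.Ventures.LatticeQCDFlow.Scoring.CloverDensityMeanZero
import HarnessLib

/-!
# The RK3 integrator of the Wilson flow commutes with the time reflection `Θ'` at every step size; hence `⟨Q⟩ = 0`, a symmetric law and vanishing odd moments hold EXACTLY for the flowed clover charge the engine measures

HONEST FRAMING: exact (Metropolis-corrected) sampling algorithms for lattice gauge theory;
figures of merit are autocorrelation/cost numbers at stated couplings and volumes; no
continuum-physics claim.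

Venture `LatticeQCDFlow` (cell pub-lqcd), sub-topic `Scoring`; FANOUT row 16 (`su2-base`).  Sequel of
`Scoring/WilsonFlowRK3` (Lüscher's third-order integrator `wilsonFlowRK3 ε` = the engine's `lc_flow_rk3_step`,
its stages `rkRegister` / `rkPush`, `expSU`, `suConj`, `flowGen`) and of the `⟨Q⟩ = 0` packet
(`Scoring/CloverChargeMeanZero`, `WilsonFlowReflectionCovariance`, `CloverChargeLawSymmetric`,
`CloverDensityMeanZero`: the Wilson measure on every torus is `Θ'`-invariant, `Θ'`-odd observables have zero
mean / symmetric tails / vanishing odd moments, the clover charge is `Θ'`-odd, the EXACT flow commutes with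
`Θ'` — `wilsonFlow_negReflect` — and with translations).  NEW WORK of the cell; nothing is cited as a fact;
no number.  Printed counterpart, NAMED ONLY: Lüscher, JHEP 08 (2010) 071, App. C.

## Why (value-free)

`WilsonFlowReflectionCovariance` closed the `⟨Q⟩ = 0` run check for the charge measured after the EXACT flow
`V_t = wilsonFlow t U`.  The engine measures `Q` on `RK3_ε^m U` (`m = t/ε` steps of `lc_flow_rk3_step`).  This
file proves `RK3_ε ∘ Θ' = Θ' ∘ RK3_ε` for EVERY `ε` — so every consequence of `Θ'`-oddness holds for the
measured charge itself, with no appeal to `ε → 0`: a measured `⟨Q⟩ ≠ 0` beyond errors indicts the sampler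
or the estimator, never the integrator.  The proof is NOT a corollary of the exact-flow statement: it rests on
the low-storage structure of Lüscher's scheme — each exponent combines the current generator with the
PREVIOUS exponent only (`17/36 = 17/9 · ¼`; `X₃ = ¾ Z₂ − X₂`), and an exponent commutes with its own
exponential (`reflReg_rkPush`); a scheme mixing `Z₀, Z₁, Z₂` with unrelated weights in the third stage
would not be covered by this argument.

## What is here (every `d ≥ 1`, `L`, `n`, every real `ε`)

* §1 `reflReg W X` — the transport of an `𝔰𝔲(n)`-valued link register under `Θ'` relative to the field `W`
  (spatial links read at `θ'x`; the temporal link `(x,0)` of `Θ'W` is the reversed link `(y,0)` of `W`,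
  `y = θ'(x+e₀)`, so `X ↦ −A⁻¹X(y,0)A`, `A = W(y,0)`); `flowGen_negReflect` (`Z(Θ'W) = reflReg W (Z W)`),
  `rkRegister_negReflect`, `rkPush_negReflect`, `reflReg_rkPush` (re-basing), and
  **`wilsonFlowRK3_negReflect`**: `RK3_ε(Θ'V) = Θ'(RK3_ε V)`; `iterate_wilsonFlowRK3_negReflect`.
* §2 (`d = 4`, `SU(n)` in the fundamental representation, `L ≥ 1`, every `β`, `ε`, `m`) for the MEASURED
  flowed charge `Q_{ε,m}(U) = Σ_x P_x(RK3_ε^m U)`: `sum_cloverPseudoscalar_iterate_wilsonFlowRK3_negReflect`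
  (`Θ'`-odd); **`wilsonExpectation_rk3CloverCharge_eq_zero`** (`⟨Q_{ε,m}⟩_{Λ,β} = 0`);
  `wilsonMeasure_rk3CloverCharge_tail_symm` (`μ{c ≤ Q} = μ{Q ≤ −c}`);
  `wilsonExpectation_rk3CloverCharge_pow_odd_eq_zero` (`⟨Q^{2k+1}⟩ = 0`); and, by translation covariance
  of the integrator (`iterate_wilsonFlowRK3_siteTranslate`) and of `μ_{Λ,β}`,
  **`wilsonExpectation_rk3CloverPseudoscalar_eq_zero`**: `⟨P_x(RK3_ε^m U)⟩ = 0` at EVERY site.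

NOT here: measurability / continuity of `RK3_ε` in the field and the push-forward form of the symmetric law
(sequel); anything about `Q²`, `τ_int`, integer rounding, cooling (see `SU2CoolingMap`); any number.
-/

noncomputable section

open Matrix MeasureTheory Literature.MathematicalPhysics.QuantumFieldTheory
open Literature.MathematicalPhysics.QuantumLattice (fundamentalRep continuous_fundamentalRep
  fundamentalRep_mem_unitaryGroup cloverPseudoscalar)

namespace Summit.Ventures.LatticeQCDFlow.Scoring

variable {d L n : ℕ}

/-! ## §1 Covariance of the integrator under the site time reflection `Θ'` -/

section Reflection

variable [NeZero d]

/-- **Reflection transport of a register relative to a field `W`.**  Under `Θ'` a spatial link is carried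
along, so its register is read at the reflected site; a temporal link `(x,0)` of `Θ'W` is the REVERSED link
`(y,0)` of `W`, `y = θ'(x+e₀)`, whose register must be transported to the other endpoint and negated:
`X ↦ −A⁻¹ X(y,0) A`, `A = W(y,0)` (if `U̇ = Z U` then `(U⁻¹)˙ = (−U⁻¹ Z U) U⁻¹`). -/
def reflReg (W : GaugeConfig d L (Matrix.specialUnitaryGroup (Fin n) ℂ)) (X : Edge d L → suAlgebra n) :
    Edge d L → suAlgebra n :=
  fun e => if e.2 = 0 then -suConj (W ((e.1.shift 0).negReflect, 0))⁻¹ (X ((e.1.shift 0).negReflect, 0))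
    else X (e.1.negReflect, e.2)

/-- `reflReg` on a temporal link. -/
theorem reflReg_apply_zero (W : GaugeConfig d L (Matrix.specialUnitaryGroup (Fin n) ℂ)) (X : Edge d L → suAlgebra n)
    (x : Site d L) :
    reflReg W X (x, 0) = -suConj (W ((x.shift 0).negReflect, 0))⁻¹ (X ((x.shift 0).negReflect, 0)) :=
  if_pos rfl

/-- `reflReg` on a spatial link. -/
theorem reflReg_apply_of_ne (W : GaugeConfig d L (Matrix.specialUnitaryGroup (Fin n) ℂ)) (X : Edge d L → suAlgebra n)
    (x : Site d L) {μ : Fin d} (hμ : μ ≠ 0) : reflReg W X (x, μ) = X (x.negReflect, μ) :=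
  if_neg hμ

/-- The zero register is reflection invariant. -/
@[simp] theorem reflReg_zero (W : GaugeConfig d L (Matrix.specialUnitaryGroup (Fin n) ℂ)) :
    reflReg W (fun _ => (0 : suAlgebra n)) = fun _ => 0 := by
  funext e
  simp [reflReg]

/-- **The generator of the reflected field is the transported generator**: `Z(Θ'W) = reflReg W (Z(W))` —
spatial links by `plaquetteLoopSum_negReflect_of_ne`, temporal links by `plaquetteLoopSum_negReflect_zero`
(`Ω_{x,0}(Θ'W) = Aᴴ Ω_{y,0}(W)ᴴ A`) with `P(AᴴMA) = AᴴP(M)A` and `P(Mᴴ) = −P(M)`. -/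
theorem flowGen_negReflect (W : GaugeConfig d L (Matrix.specialUnitaryGroup (Fin n) ℂ)) :
    flowGen W.negReflect = reflReg W (flowGen W) := by
  funext e
  obtain ⟨x, μ⟩ := e
  apply Subtype.ext
  by_cases hμ : μ = 0
  · subst hμ
    set A : Matrix (Fin n) (Fin n) ℂ :=
      ((W ((x.shift 0).negReflect, 0) : Matrix.specialUnitaryGroup (Fin n) ℂ) : Matrix (Fin n) (Fin n) ℂ) with hA
    have hAu : A ∈ Matrix.unitaryGroup (Fin n) ℂ := (W ((x.shift 0).negReflect, 0)).2.1
    have hg : star A ∈ Matrix.unitaryGroup (Fin n) ℂ := Unitary.star_mem hAu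
    have key := suProj_unitary_conj hg (plaquetteLoopSum W (x.shift 0).negReflect 0)ᴴ
    rw [star_star, Matrix.star_eq_conjTranspose, suProj_conjTranspose_eq_neg] at key
    rw [reflReg_apply_zero, Submodule.coe_neg, coe_suConj, coe_flowGen, coe_flowGen, WilsonFlow.coe_inv_SU, ← hA,
      plaquetteLoopSum_negReflect_zero, ← hA, key, Matrix.conjTranspose_conjTranspose]
  · rw [reflReg_apply_of_ne _ _ _ hμ, coe_flowGen, coe_flowGen, plaquetteLoopSum_negReflect_of_ne W x hμ]

/-- Register updates commute with the reflection transport. -/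
theorem rkRegister_negReflect (a b ε : ℝ) (X : Edge d L → suAlgebra n)
    (W : GaugeConfig d L (Matrix.specialUnitaryGroup (Fin n) ℂ)) :
    rkRegister a b ε (reflReg W X) W.negReflect = reflReg W (rkRegister a b ε X W) := by
  funext e
  obtain ⟨x, μ⟩ := e
  by_cases hμ : μ = 0
  · subst hμ
    simp only [rkRegister, flowGen_negReflect W, reflReg_apply_zero, suConj_add, suConj_smul, neg_add, smul_neg]
  · simp only [rkRegister, flowGen_negReflect W, reflReg_apply_of_ne _ _ _ hμ]

/-- **Exponential pushes commute with `Θ'`**: on a temporal link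
`e^{−A⁻¹XA} · A⁻¹ = A⁻¹ e^{−X} = (e^X A)⁻¹`. -/
theorem rkPush_negReflect (X : Edge d L → suAlgebra n) (W : GaugeConfig d L (Matrix.specialUnitaryGroup (Fin n) ℂ)) :
    rkPush (reflReg W X) W.negReflect = (rkPush X W).negReflect := by
  funext e
  obtain ⟨x, μ⟩ := e
  by_cases hμ : μ = 0
  · subst hμ
    rw [rkPush, reflReg_apply_zero, expSU_neg, expSU_suConj, negReflect_apply_zero_shift,
      negReflect_apply_zero_shift]
    simp only [rkPush]
    group
  · rw [rkPush, reflReg_apply_of_ne _ _ _ hμ, negReflect_apply_of_ne _ _ hμ, negReflect_apply_of_ne _ _ hμ]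
    simp only [rkPush]

/-- **Re-basing the transport**: transporting relative to the pushed field `e^X W` is the same as relative
to `W`, because `e^{X(y,0)}` commutes with `X(y,0)`.  This is where the structure of a LOW-STORAGE scheme
enters: each exponent is a combination of the current generator and the PREVIOUS exponent only. -/
theorem reflReg_rkPush (X : Edge d L → suAlgebra n) (W : GaugeConfig d L (Matrix.specialUnitaryGroup (Fin n) ℂ)) :
    reflReg (rkPush X W) X = reflReg W X := by
  funext e
  obtain ⟨x, μ⟩ := e
  by_cases hμ : μ = 0
  · subst hμ
    rw [reflReg_apply_zero, reflReg_apply_zero]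
    congr 1
    apply Subtype.ext
    rw [coe_suConj, coe_suConj, WilsonFlow.coe_inv_SU, WilsonFlow.coe_inv_SU, Matrix.conjTranspose_conjTranspose,
      Matrix.conjTranspose_conjTranspose, rkPush, WilsonFlow.coe_mul_SU, coe_expSU, Matrix.conjTranspose_mul]
    set A : Matrix (Fin n) (Fin n) ℂ :=
      ((W ((x.shift 0).negReflect, 0) : Matrix.specialUnitaryGroup (Fin n) ℂ) : Matrix (Fin n) (Fin n) ℂ)
    set Y : Matrix (Fin n) (Fin n) ℂ := ((X ((x.shift 0).negReflect, 0) : suAlgebra n) : Matrix (Fin n) (Fin n) ℂ)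
    calc Aᴴ * (NormedSpace.exp Y)ᴴ * Y * (NormedSpace.exp Y * A)
        = Aᴴ * ((NormedSpace.exp Y)ᴴ * Y * NormedSpace.exp Y) * A := by simp only [Matrix.mul_assoc]
      _ = Aᴴ * Y * A := by rw [conjTranspose_exp_mul_mul_exp]
  · rw [reflReg_apply_of_ne _ _ _ hμ, reflReg_apply_of_ne _ _ _ hμ]

/-- **The integrator commutes with the time reflection, at every step size**: `RK3_ε(Θ'V) = Θ'(RK3_ε V)`.
Stage by stage: the register of the reflected field is the transported register (`rkRegister_negReflect`),
the push of the transported register is the reflected push (`rkPush_negReflect`), and the transport may be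
re-based to the pushed field before the next stage (`reflReg_rkPush`). -/
theorem wilsonFlowRK3_negReflect (ε : ℝ) (V : GaugeConfig d L (Matrix.specialUnitaryGroup (Fin n) ℂ)) :
    wilsonFlowRK3 ε V.negReflect = (wilsonFlowRK3 ε V).negReflect := by
  simp only [wilsonFlowRK3]
  set X₁ := rkRegister (1 / 4) 0 ε (fun _ => (0 : suAlgebra n)) V with hX₁
  set W₁ := rkPush X₁ V with hW₁
  set X₂ := rkRegister (8 / 9) (-17 / 9) ε X₁ W₁ with hX₂
  set W₂ := rkPush X₂ W₁ with hW₂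
  set X₃ := rkRegister (3 / 4) (-1) ε X₂ W₂ with hX₃
  have h1 : rkRegister (1 / 4) 0 ε (fun _ => (0 : suAlgebra n)) V.negReflect = reflReg W₁ X₁ := by
    rw [← reflReg_zero V, rkRegister_negReflect, ← hX₁, hW₁, reflReg_rkPush]
  have h1' : rkPush (reflReg W₁ X₁) V.negReflect = W₁.negReflect := by
    rw [hW₁, reflReg_rkPush, rkPush_negReflect]
  have h2 : rkRegister (8 / 9) (-17 / 9) ε (reflReg W₁ X₁) W₁.negReflect = reflReg W₂ X₂ := by
    rw [rkRegister_negReflect, ← hX₂, hW₂, reflReg_rkPush]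
  have h2' : rkPush (reflReg W₂ X₂) W₁.negReflect = W₂.negReflect := by
    rw [hW₂, reflReg_rkPush, rkPush_negReflect]
  have h3 : rkRegister (3 / 4) (-1) ε (reflReg W₂ X₂) W₂.negReflect = reflReg W₂ X₃ := by
    rw [rkRegister_negReflect, ← hX₃]
  rw [h1, h1', h2, h2', h3, rkPush_negReflect]

omit [NeZero d] in
/-- The same for any number of steps. -/
theorem iterate_wilsonFlowRK3_negReflect [NeZero d] (ε : ℝ) (m : ℕ)
    (V : GaugeConfig d L (Matrix.specialUnitaryGroup (Fin n) ℂ)) :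
    (wilsonFlowRK3 ε)^[m] V.negReflect = ((wilsonFlowRK3 ε)^[m] V).negReflect :=
  Function.Commute.iterate_left (g := GaugeConfig.negReflect) (fun U => wilsonFlowRK3_negReflect ε U) m V

end Reflection

/-! ## §2 The flowed clover charge as the engine measures it -/

section MeasuredCharge

variable {L n : ℕ} [NeZero L]

/-- **The measured flowed charge is `Θ'`-odd**: `Q_{ε,m}(Θ'U) = −Q_{ε,m}(U)` for
`Q_{ε,m}(U) = Σ_x P_x(RK3_ε^m U)` (integrator covariance + `sum_cloverPseudoscalar_negReflect`). -/
theorem sum_cloverPseudoscalar_iterate_wilsonFlowRK3_negReflect (ε : ℝ) (m : ℕ)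
    (U : GaugeConfig 4 L (Matrix.specialUnitaryGroup (Fin n) ℂ)) :
    ∑ x : Site 4 L, cloverPseudoscalar (fundamentalRep (Fin n)) x ((wilsonFlowRK3 ε)^[m] U.negReflect) =
      -∑ x : Site 4 L, cloverPseudoscalar (fundamentalRep (Fin n)) x ((wilsonFlowRK3 ε)^[m] U) := by
  rw [iterate_wilsonFlowRK3_negReflect]
  exact sum_cloverPseudoscalar_negReflect (fundamentalRep (Fin n)) fundamentalRep_mem_unitaryGroup _

/-- **`⟨Q_{ε,m}⟩_{Λ,β} = 0` for the measured flowed clover charge.**  For the Wilson theory of `SU(n)`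
(fundamental representation) on `(ℤ/L)^4`, every `L ≥ 1`, EVERY real `β`, EVERY step size `ε` and EVERY
number of steps `m`, the Wilson-measure mean of the total clover charge of `RK3_ε^m U` vanishes. -/
theorem wilsonExpectation_rk3CloverCharge_eq_zero (n : ℕ) (β ε : ℝ) (m : ℕ) :
    wilsonExpectation (fundamentalRep (Fin n)) β
      (fun U : GaugeConfig 4 L (Matrix.specialUnitaryGroup (Fin n) ℂ) =>
        ∑ x : Site 4 L, cloverPseudoscalar (fundamentalRep (Fin n)) x ((wilsonFlowRK3 ε)^[m] U)) = 0 :=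
  wilsonExpectation_eq_zero_of_negReflect_odd (fundamentalRep (Fin n)) (continuous_fundamentalRep (Fin n)) β
    fun U => sum_cloverPseudoscalar_iterate_wilsonFlowRK3_negReflect ε m U

/-- **Tail symmetry of the measured flowed charge**: `μ_{Λ,β}{c ≤ Q_{ε,m}} = μ_{Λ,β}{Q_{ε,m} ≤ −c}` for
every real `c` — the law of `Q_{ε,m}` is symmetric about `0` (no measurability needed in this form). -/
theorem wilsonMeasure_rk3CloverCharge_tail_symm (n : ℕ) (β ε : ℝ) (m : ℕ) (c : ℝ) :
    wilsonMeasure (fundamentalRep (Fin n)) β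
        {U : GaugeConfig 4 L (Matrix.specialUnitaryGroup (Fin n) ℂ) |
          c ≤ ∑ x : Site 4 L, cloverPseudoscalar (fundamentalRep (Fin n)) x ((wilsonFlowRK3 ε)^[m] U)} =
      wilsonMeasure (fundamentalRep (Fin n)) β
        {U : GaugeConfig 4 L (Matrix.specialUnitaryGroup (Fin n) ℂ) |
          ∑ x : Site 4 L, cloverPseudoscalar (fundamentalRep (Fin n)) x ((wilsonFlowRK3 ε)^[m] U) ≤ -c} :=
  wilsonMeasure_tail_symm_of_negReflect_odd (fundamentalRep (Fin n)) (continuous_fundamentalRep (Fin n)) β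
    (fun U => sum_cloverPseudoscalar_iterate_wilsonFlowRK3_negReflect ε m U) c

/-- **All odd moments of the measured flowed charge vanish**: `⟨Q_{ε,m}^{2k+1}⟩_{Λ,β} = 0`. -/
theorem wilsonExpectation_rk3CloverCharge_pow_odd_eq_zero (n : ℕ) (β ε : ℝ) (m k : ℕ) :
    wilsonExpectation (fundamentalRep (Fin n)) β
      (fun U : GaugeConfig 4 L (Matrix.specialUnitaryGroup (Fin n) ℂ) =>
        (∑ x : Site 4 L, cloverPseudoscalar (fundamentalRep (Fin n)) x ((wilsonFlowRK3 ε)^[m] U)) ^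
          (2 * k + 1)) = 0 :=
  wilsonExpectation_pow_odd_eq_zero_of_negReflect_odd (fundamentalRep (Fin n))
    (continuous_fundamentalRep (Fin n)) β (fun U => sum_cloverPseudoscalar_iterate_wilsonFlowRK3_negReflect ε m U) k

omit [NeZero L] in
/-- The RK3 integrator commutes with the torus translations of `TorusConfigShift`
(`iterate_wilsonFlowRK3_siteTranslate` in the `torusConfigShift` spelling). -/
theorem iterate_wilsonFlowRK3_torusConfigShift (ε : ℝ) (m : ℕ) (v : Site d L)
    (U : GaugeConfig d L (Matrix.specialUnitaryGroup (Fin n) ℂ)) :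
    (wilsonFlowRK3 ε)^[m] (TorusTranslation.torusConfigShift v U) =
      TorusTranslation.torusConfigShift v ((wilsonFlowRK3 ε)^[m] U) := by
  rw [torusConfigShift_eq_siteTranslate, torusConfigShift_eq_siteTranslate, iterate_wilsonFlowRK3_siteTranslate]

omit [NeZero L] in
/-- The measured flowed clover density at the origin is `Θ'`-odd: `P_0(RK3_ε^m(Θ'U)) = −P_0(RK3_ε^m U)`. -/
theorem cloverPseudoscalar_iterate_wilsonFlowRK3_negReflect_zero_site (ε : ℝ) (m : ℕ)
    (U : GaugeConfig 4 L (Matrix.specialUnitaryGroup (Fin n) ℂ)) :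
    cloverPseudoscalar (fundamentalRep (Fin n)) 0 ((wilsonFlowRK3 ε)^[m] U.negReflect) =
      -cloverPseudoscalar (fundamentalRep (Fin n)) 0 ((wilsonFlowRK3 ε)^[m] U) := by
  rw [iterate_wilsonFlowRK3_negReflect, cloverPseudoscalar_negReflect (fundamentalRep (Fin n))
    fundamentalRep_mem_unitaryGroup, negReflect_zero_site]

/-- **`⟨P_x(RK3_ε^m U)⟩_{Λ,β} = 0` at EVERY site**, every `β`, `ε`, `m`, `L ≥ 1`, `n`: translate to the origin
(`iterate_wilsonFlowRK3_torusConfigShift`, translation invariance of `μ_{Λ,β}`: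
`wilsonExpectation_comp_torusConfigShift`), where the density is `Θ'`-odd. -/
theorem wilsonExpectation_rk3CloverPseudoscalar_eq_zero (n : ℕ) (β ε : ℝ) (m : ℕ) (x : Site 4 L) :
    wilsonExpectation (fundamentalRep (Fin n)) β
      (fun U : GaugeConfig 4 L (Matrix.specialUnitaryGroup (Fin n) ℂ) =>
        cloverPseudoscalar (fundamentalRep (Fin n)) x ((wilsonFlowRK3 ε)^[m] U)) = 0 := by
  have h0 : wilsonExpectation (fundamentalRep (Fin n)) β
      (fun U : GaugeConfig 4 L (Matrix.specialUnitaryGroup (Fin n) ℂ) =>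
        cloverPseudoscalar (fundamentalRep (Fin n)) 0 ((wilsonFlowRK3 ε)^[m] U)) = 0 :=
    wilsonExpectation_eq_zero_of_negReflect_odd (fundamentalRep (Fin n)) (continuous_fundamentalRep (Fin n)) β
      fun U => cloverPseudoscalar_iterate_wilsonFlowRK3_negReflect_zero_site ε m U
  have hshift := wilsonExpectation_comp_torusConfigShift (fundamentalRep (Fin n)) β (-x)
    (fun U : GaugeConfig 4 L (Matrix.specialUnitaryGroup (Fin n) ℂ) =>
      cloverPseudoscalar (fundamentalRep (Fin n)) 0 ((wilsonFlowRK3 ε)^[m] U))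
  have hfun : ((fun U : GaugeConfig 4 L (Matrix.specialUnitaryGroup (Fin n) ℂ) =>
      cloverPseudoscalar (fundamentalRep (Fin n)) 0 ((wilsonFlowRK3 ε)^[m] U)) ∘
        TorusTranslation.torusConfigShift (-x)) =
      fun U => cloverPseudoscalar (fundamentalRep (Fin n)) x ((wilsonFlowRK3 ε)^[m] U) := by
    funext U
    rw [Function.comp_apply, iterate_wilsonFlowRK3_torusConfigShift, cloverPseudoscalar_torusConfigShift, zero_sub,
      neg_neg]
  rw [hfun, h0] at hshift
  exact hshift

end MeasuredCharge

end Summit.Ventures.LatticeQCDFlow.Scoring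

end
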